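import Mathlib
import Literature.MathematicalPhysics.StatisticalMechanics.LennardJonesClusters
import Literature.Barriers.AtomisticToContinuum.StickySphereClustersNarrow
import HarnessLib

/-!
# Rigid-translation surgery for Lennard-Jones ground states: no planar gap wider than `1`

Helper file of line `Sketch`, crux `LjLaminarWindows` (stmt-AtomisticToContinuum-6711), towards the
cohesion input `stub_noFoam` (≡ stmt-AtomisticToContinuum-13453): finite (not infinitesimal)
surgery inequalities.

A ground state `x : Fin N → ℝᵈ` of `V_LJ(r) = r⁻¹²/12 - r⁻⁶/6` cannot lower its energy when a
group `S` of particles is translated rigidly by a vector `v`, as long as the translated particles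
avoid the fixed ones; since the intra-group and extra-group terms do not change, **the cross
interaction `∑_{p ∈ S} ∑_{k ∉ S} V_LJ(|x_p - x_k|)` is minimal among all admissible translates**
(`surgery_cross_le_translate`).  Pushing the group along a unit vector `u` by `t > 0` shortens
every cross distance whose height difference `⟪x_k - x_p, u⟫` is at least `1 + t` while keeping
it `≥ 1`, where `V_LJ` is strictly increasing; hence (`surgery_exists_cross_inner_le_one`)
**for every unit vector `u` and every non-empty proper group `S`, some member `p ∈ S` and some
non-member `k ∉ S` have `⟪x_k - x_p, u⟫ ≤ 1`**: a Lennard-Jones ground state has no planar gap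
(empty slab separating two non-empty parts) of width `> 1` in any direction, in any dimension
(`surgery_exists_mem_slab`: between an occupied height `≤ c` and an occupied height `> c + 1`
there is an occupied height in `(c, c + 1]`).  All statements `[folklore]` (translation /
"two groups attract" arguments, Blanc–Lewin 2015, §1.2).
-/

noncomputable section

open scoped BigOperators InnerProductSpace
open Filter Topology
open Literature.MathematicalPhysics.StatisticalMechanics
open Literature.Barriers.AtomisticToContinuum (strictMonoOn_lennardJones)

namespace Summit.AtomisticToContinuum.Crystallization.Theorems.LjLaminarWindowsSketch

variable {d N : ℕ}

/-! ## Rigid translation of a group of particles -/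

/-- **Translation surgery.** In a Lennard-Jones ground state `x` (any dimension), for every group
`S` of particles and every vector `v` such that the translated particles `x_p + v` (`p ∈ S`) avoid
the fixed particles `x_k` (`k ∉ S`), the cross interaction does not decrease:
`∑_{p ∈ S} ∑_{k ∉ S} V_LJ(|x_p - x_k|) ≤ ∑_{p ∈ S} ∑_{k ∉ S} V_LJ(|x_p + v - x_k|)`
(the translated configuration consists of distinct points, its energy is `≥ E(N) = 𝓔(x)`, and the
intra-`S` and intra-`Sᶜ` terms are translation invariant). [folklore] -/
theorem surgery_cross_le_translate {x : Fin N → EuclideanSpace ℝ (Fin d)}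
    (hx : IsGroundState lennardJones x) (S : Finset (Fin N)) (v : EuclideanSpace ℝ (Fin d))
    (hv : ∀ p ∈ S, ∀ k ∈ Sᶜ, x p + v ≠ x k) :
    ∑ p ∈ S, ∑ k ∈ Sᶜ, lennardJones (dist (x p) (x k)) ≤
      ∑ p ∈ S, ∑ k ∈ Sᶜ, lennardJones (dist (x p + v) (x k)) := by
  -- the translated configuration `y`
  set y : Fin N → EuclideanSpace ℝ (Fin d) := fun i => if i ∈ S then x i + v else x i with hy
  have hyS : ∀ i ∈ S, y i = x i + v := fun i hi => by simp [hy, hi]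
  have hyC : ∀ i ∈ Sᶜ, y i = x i := fun i hi => by simp [hy, Finset.mem_compl.1 hi]
  have hinj : Function.Injective y := by
    intro a b hab
    by_cases ha : a ∈ S <;> by_cases hb : b ∈ S
    · rw [hyS a ha, hyS b hb] at hab
      exact hx.1 (add_right_cancel hab)
    · rw [hyS a ha, hyC b (Finset.mem_compl.2 hb)] at hab
      exact absurd hab (hv a ha b (Finset.mem_compl.2 hb))
    · rw [hyC a (Finset.mem_compl.2 ha), hyS b hb] at hab
      exact absurd hab.symm (hv b hb a (Finset.mem_compl.2 ha))
    · rw [hyC a (Finset.mem_compl.2 ha), hyC b (Finset.mem_compl.2 hb)] at hab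
      exact hx.1 hab
  have hle : interactionEnergy lennardJones x ≤ interactionEnergy lennardJones y := by
    rw [hx.2]
    exact groundStateEnergy_lennardJones_le hinj
  -- double sums, split along `S`
  have hxE := two_mul_interactionEnergy_eq_sum_sum lennardJones lennardJones_zero x
  have hyE := two_mul_interactionEnergy_eq_sum_sum lennardJones lennardJones_zero y
  rw [sum_sum_eq_add_compl _ S] at hxE hyE
  have hSS : ∑ i ∈ S, ∑ k ∈ S, lennardJones (dist (y i) (y k)) =
      ∑ i ∈ S, ∑ k ∈ S, lennardJones (dist (x i) (x k)) :=
    Finset.sum_congr rfl fun i hi => Finset.sum_congr rfl fun k hk => by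
      rw [hyS i hi, hyS k hk, dist_add_right]
  have hCC : ∑ i ∈ Sᶜ, ∑ k ∈ Sᶜ, lennardJones (dist (y i) (y k)) =
      ∑ i ∈ Sᶜ, ∑ k ∈ Sᶜ, lennardJones (dist (x i) (x k)) :=
    Finset.sum_congr rfl fun i hi => Finset.sum_congr rfl fun k hk => by
      rw [hyC i hi, hyC k hk]
  have hSC : ∑ i ∈ S, ∑ k ∈ Sᶜ, lennardJones (dist (y i) (y k)) =
      ∑ p ∈ S, ∑ k ∈ Sᶜ, lennardJones (dist (x p + v) (x k)) :=
    Finset.sum_congr rfl fun i hi => Finset.sum_congr rfl fun k hk => by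
      rw [hyS i hi, hyC k hk]
  have hCS : ∑ i ∈ Sᶜ, ∑ k ∈ S, lennardJones (dist (y i) (y k)) =
      ∑ p ∈ S, ∑ k ∈ Sᶜ, lennardJones (dist (x p + v) (x k)) := by
    rw [Finset.sum_comm]
    refine Finset.sum_congr rfl fun p hp => Finset.sum_congr rfl fun k hk => ?_
    rw [hyS p hp, hyC k hk, dist_comm]
  have hCS0 : ∑ i ∈ Sᶜ, ∑ k ∈ S, lennardJones (dist (x i) (x k)) =
      ∑ p ∈ S, ∑ k ∈ Sᶜ, lennardJones (dist (x p) (x k)) := by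
    rw [Finset.sum_comm]
    exact Finset.sum_congr rfl fun p _ => Finset.sum_congr rfl fun k _ => by rw [dist_comm]
  rw [hSS, hCC, hSC, hCS] at hyE
  rw [hCS0] at hxE
  linarith

/-! ## Pushing along a unit vector -/

/-- If `‖u‖ = 1`, `t > 0` and `⟪w, u⟫ ≥ 1 + t`, then `w - t u` still has norm `≥ 1`:
`‖w - t u‖ ≥ ⟪w - t u, u⟫ = ⟪w, u⟫ - t ≥ 1`. [folklore] -/
theorem surgery_one_le_norm_sub_smul {F : Type*} [NormedAddCommGroup F] [InnerProductSpace ℝ F]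
    {w u : F} (hu : ‖u‖ = 1) {t : ℝ} (h : 1 + t ≤ ⟪w, u⟫_ℝ) : 1 ≤ ‖w - t • u‖ := by
  have h1 : ⟪w - t • u, u⟫_ℝ = ⟪w, u⟫_ℝ - t := by
    rw [inner_sub_left, real_inner_smul_left, real_inner_self_eq_norm_sq, hu]
    ring
  have h2 : ⟪w - t • u, u⟫_ℝ ≤ ‖w - t • u‖ := by
    have := real_inner_le_norm (w - t • u) u
    rwa [hu, mul_one] at this
  linarith

/-- If `‖u‖ = 1`, `t > 0` and `⟪w, u⟫ ≥ 1 + t`, then `w - t u` is strictly shorter than `w`: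
`‖w - t u‖² = ‖w‖² - t (2⟪w, u⟫ - t) < ‖w‖²`. [folklore] -/
theorem surgery_norm_sub_smul_lt {F : Type*} [NormedAddCommGroup F] [InnerProductSpace ℝ F]
    {w u : F} (hu : ‖u‖ = 1) {t : ℝ} (ht : 0 < t) (h : 1 + t ≤ ⟪w, u⟫_ℝ) :
    ‖w - t • u‖ < ‖w‖ := by
  have hsq : ‖w - t • u‖ ^ 2 = ‖w‖ ^ 2 - t * (2 * ⟪w, u⟫_ℝ - t) := by
    rw [@norm_sub_sq_real, real_inner_smul_right, norm_smul, Real.norm_eq_abs, abs_of_pos ht, hu]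
    ring
  have hlt : ‖w - t • u‖ ^ 2 < ‖w‖ ^ 2 := by
    rw [hsq]
    nlinarith
  exact lt_of_pow_lt_pow_left₀ 2 (norm_nonneg _) hlt

/-! ## No planar gap wider than `1` -/

/-- **No planar gap wider than `1` (group form).** In a Lennard-Jones ground state `x` in `ℝᵈ`,
for every unit vector `u` and every group `S` of particles with `S` and `Sᶜ` non-empty, some
`p ∈ S` and `k ∉ S` satisfy `⟪x_k - x_p, u⟫ ≤ 1`.  Otherwise the least cross height difference
`m` exceeds `1`; translating `S` by `(m - 1) u` keeps every cross distance `≥ 1` and shortens it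
strictly, so every cross term `V_LJ` decreases strictly (`V_LJ` is strictly increasing on
`[1, ∞)`), contradicting `surgery_cross_le_translate`. [folklore] -/
theorem surgery_exists_cross_inner_le_one {x : Fin N → EuclideanSpace ℝ (Fin d)}
    (hx : IsGroundState lennardJones x) {u : EuclideanSpace ℝ (Fin d)} (hu : ‖u‖ = 1)
    (S : Finset (Fin N)) (hS : S.Nonempty) (hSc : Sᶜ.Nonempty) :
    ∃ p ∈ S, ∃ k ∈ Sᶜ, ⟪x k - x p, u⟫_ℝ ≤ 1 := by
  by_contra hcon
  push Not at hcon
  -- the least cross height difference `m > 1`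
  obtain ⟨q, hq, hmin⟩ := (S ×ˢ Sᶜ).exists_min_image
    (fun pk : Fin N × Fin N => ⟪x pk.2 - x pk.1, u⟫_ℝ) (hS.product hSc)
  obtain ⟨hq1, hq2⟩ := Finset.mem_product.1 hq
  set m : ℝ := ⟪x q.2 - x q.1, u⟫_ℝ with hm
  have hm1 : 1 < m := hcon q.1 hq1 q.2 hq2
  set t : ℝ := m - 1 with ht
  have ht0 : 0 < t := by rw [ht]; linarith
  have hge : ∀ p ∈ S, ∀ k ∈ Sᶜ, 1 + t ≤ ⟪x k - x p, u⟫_ℝ := fun p hp k hk => by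
    have := hmin (p, k) (Finset.mem_product.2 ⟨hp, hk⟩)
    rw [ht]
    linarith
  -- after the push by `t u`, every cross distance is `≥ 1` and strictly shorter
  have hdist : ∀ p ∈ S, ∀ k ∈ Sᶜ,
      dist (x p + t • u) (x k) = ‖(x k - x p) - t • u‖ := fun p _ k _ => by
    rw [dist_comm, dist_eq_norm]
    congr 1
    abel
  have hone : ∀ p ∈ S, ∀ k ∈ Sᶜ, 1 ≤ dist (x p + t • u) (x k) := fun p hp k hk => by
    rw [hdist p hp k hk]
    exact surgery_one_le_norm_sub_smul hu (hge p hp k hk)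
  have hlt : ∀ p ∈ S, ∀ k ∈ Sᶜ, dist (x p + t • u) (x k) < dist (x p) (x k) := fun p hp k hk => by
    rw [hdist p hp k hk, dist_comm, dist_eq_norm]
    exact surgery_norm_sub_smul_lt hu ht0 (hge p hp k hk)
  have hv : ∀ p ∈ S, ∀ k ∈ Sᶜ, x p + t • u ≠ x k := fun p hp k hk h => by
    have := hone p hp k hk
    rw [h, dist_self] at this
    exact absurd this (by norm_num)
  have hle := surgery_cross_le_translate hx S (t • u) hv
  have hsum : ∑ p ∈ S, ∑ k ∈ Sᶜ, lennardJones (dist (x p + t • u) (x k)) <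
      ∑ p ∈ S, ∑ k ∈ Sᶜ, lennardJones (dist (x p) (x k)) :=
    Finset.sum_lt_sum_of_nonempty hS fun p hp =>
      Finset.sum_lt_sum_of_nonempty hSc fun k hk =>
        strictMonoOn_lennardJones (Set.mem_Ici.2 (hone p hp k hk))
          (Set.mem_Ici.2 ((hone p hp k hk).trans (hlt p hp k hk).le)) (hlt p hp k hk)
  linarith

/-- **No planar gap wider than `1` (slab form).** In a Lennard-Jones ground state `x` in `ℝᵈ`
and for every unit vector `u` and level `c`: if some particle has height `⟪x_p, u⟫ ≤ c` and some
particle has height `> c + 1`, then some particle has height in `(c, c + 1]` — the occupied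
heights of a ground state leave no gap longer than `1` inside their range. [folklore] -/
theorem surgery_exists_mem_slab {x : Fin N → EuclideanSpace ℝ (Fin d)}
    (hx : IsGroundState lennardJones x) {u : EuclideanSpace ℝ (Fin d)} (hu : ‖u‖ = 1) (c : ℝ)
    (hlow : ∃ p, ⟪x p, u⟫_ℝ ≤ c) (hhigh : ∃ k, c + 1 < ⟪x k, u⟫_ℝ) :
    ∃ i, c < ⟪x i, u⟫_ℝ ∧ ⟪x i, u⟫_ℝ ≤ c + 1 := by
  classical
  obtain ⟨p₀, hp₀⟩ := hlow
  obtain ⟨k₀, hk₀⟩ := hhigh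
  set S : Finset (Fin N) := Finset.univ.filter fun p => ⟪x p, u⟫_ℝ ≤ c with hS
  have hSne : S.Nonempty := ⟨p₀, by simp [hS, hp₀]⟩
  have hScne : Sᶜ.Nonempty := ⟨k₀, by
    rw [Finset.mem_compl]
    simp only [hS, Finset.mem_filter, Finset.mem_univ, true_and, not_le]
    linarith⟩
  obtain ⟨p, hp, k, hk, hpk⟩ := surgery_exists_cross_inner_le_one hx hu S hSne hScne
  have hp' : ⟪x p, u⟫_ℝ ≤ c := by simpa [hS] using hp
  have hk' : c < ⟪x k, u⟫_ℝ := by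
    rw [Finset.mem_compl] at hk
    simpa [hS] using hk
  refine ⟨k, hk', ?_⟩
  rw [inner_sub_left] at hpk
  linarith

/-- **Registered sub-goal `stub_noPlanarGap` of line `Sketch` (cohesion side, toward `stub_noFoam`):
no planar gap wider than the equilibrium distance.** For every Lennard-Jones ground state in `ℝᵈ`,
every unit vector `u` and every group `S` with `S`, `Sᶜ` non-empty, some `p ∈ S`, `k ∉ S` have
`⟪x_k - x_p, u⟫ ≤ 1`. [folklore] -/
theorem stub_noPlanarGap :
    ∀ (d N : ℕ) (x : Fin N → EuclideanSpace ℝ (Fin d)), IsGroundState lennardJones x →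
      ∀ u : EuclideanSpace ℝ (Fin d), ‖u‖ = 1 → ∀ S : Finset (Fin N), S.Nonempty → Sᶜ.Nonempty →
        ∃ p ∈ S, ∃ k ∈ Sᶜ, inner ℝ (x k - x p) u ≤ 1 :=
  fun _ _ _ hx _ hu S hS hSc => surgery_exists_cross_inner_le_one hx hu S hS hSc

/-! ## Docking: every group binds to its complement by at least one bond -/

/-- **Group binding inequality.** In a Lennard-Jones ground state `x` in `ℝᵈ`, every group `S` of
particles with `S` and `Sᶜ` non-empty binds to its complement by at least one full bond:
`∑_{p ∈ S} ∑_{k ∉ S} V_LJ(|x_p - x_k|) ≤ V_LJ(1) = -1/12` (for `S = {i}` this is the insertion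
bound `𝓔ⁱ(x) ≤ -1/12`).  Docking construction: slide `S` rigidly along `e = x_{k₀} - x_{p₀}`; the
least cross distance is a continuous function of the slide parameter, `≤ 1` when `p₀` reaches
`x_{k₀}` and `≥ 1` far away, so some slide has least cross distance EXACTLY `1`: there all cross
terms are `≤ 0` and one equals `-1/12`, and by `surgery_cross_le_translate` the actual cross
interaction is not larger. [folklore] -/
theorem surgery_cross_le_lennardJones_one {x : Fin N → EuclideanSpace ℝ (Fin d)}
    (hx : IsGroundState lennardJones x) (S : Finset (Fin N)) (hS : S.Nonempty)
    (hSc : Sᶜ.Nonempty) :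
    ∑ p ∈ S, ∑ k ∈ Sᶜ, lennardJones (dist (x p) (x k)) ≤ -1 / 12 := by
  classical
  obtain ⟨p₀, hp₀⟩ := hS
  obtain ⟨k₀, hk₀⟩ := hSc
  have hq₀ : (p₀, k₀) ∈ S ×ˢ Sᶜ := Finset.mem_product.2 ⟨hp₀, hk₀⟩
  have hPK : (S ×ˢ Sᶜ).Nonempty := ⟨(p₀, k₀), hq₀⟩
  have hpk₀ : p₀ ≠ k₀ := fun h => (Finset.mem_compl.1 hk₀) (h ▸ hp₀)
  -- slide direction and the least cross distance `f τ` after sliding `S` by `τ • e`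
  set e : EuclideanSpace ℝ (Fin d) := x k₀ - x p₀ with he
  have he0 : 0 < ‖e‖ := norm_pos_iff.2 (sub_ne_zero.2 (hx.1.ne hpk₀.symm))
  set f : ℝ → ℝ := fun τ =>
    (S ×ˢ Sᶜ).inf' hPK fun pk : Fin N × Fin N => dist (x pk.1 + τ • e) (x pk.2) with hf
  have hfc : Continuous f :=
    Continuous.finset_inf'_apply hPK fun pk _ => by fun_prop
  -- `f 1 ≤ 1`: the pair `(p₀, k₀)` collides
  have hf1 : f 1 ≤ 1 := by
    refine (Finset.inf'_le _ hq₀).trans ?_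
    simp [he]
  -- `f T ≥ 1` for `T = (1 + D)/‖e‖`, `D` the largest cross distance
  set D : ℝ := (S ×ˢ Sᶜ).sup' hPK fun pk : Fin N × Fin N => dist (x pk.1) (x pk.2) with hD
  have hDge : ∀ pk ∈ S ×ˢ Sᶜ, dist (x pk.1) (x pk.2) ≤ D := fun pk hpk =>
    Finset.le_sup' (fun pk : Fin N × Fin N => dist (x pk.1) (x pk.2)) hpk
  have hD0 : 0 ≤ D := dist_nonneg.trans (hDge _ hq₀)
  have hDe : ‖e‖ ≤ D := by
    have := hDge _ hq₀
    rwa [he, ← dist_eq_norm, dist_comm]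
  set T : ℝ := (1 + D) / ‖e‖ with hT
  have hT1 : 1 ≤ T := by
    rw [hT, le_div_iff₀ he0]
    linarith
  have hfT : 1 ≤ f T := by
    refine Finset.le_inf' _ _ fun pk hpk => ?_
    have h1 : ‖T • e‖ = 1 + D := by
      rw [norm_smul, Real.norm_eq_abs, abs_of_nonneg (by positivity), hT, div_mul_cancel₀ _ he0.ne']
    have h2 : ‖T • e‖ - dist (x pk.1) (x pk.2) ≤ dist (x pk.1 + T • e) (x pk.2) := by
      rw [dist_eq_norm, dist_eq_norm]
      have := norm_sub_norm_le (T • e) (x pk.2 - x pk.1)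
      have hrw : T • e - (x pk.2 - x pk.1) = x pk.1 + T • e - x pk.2 := by abel
      rw [hrw, ← dist_eq_norm, dist_comm, dist_eq_norm] at this
      linarith
    linarith [hDge pk hpk]
  -- intermediate value: some slide `τ ∈ [1, T]` has least cross distance exactly `1`
  obtain ⟨τ, -, hτ⟩ : ∃ τ ∈ Set.Icc 1 T, f τ = 1 :=
    intermediate_value_Icc hT1 hfc.continuousOn ⟨hf1, hfT⟩
  have hge1 : ∀ p ∈ S, ∀ k ∈ Sᶜ, 1 ≤ dist (x p + τ • e) (x k) := fun p hp k hk => by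
    have hmem : (p, k) ∈ S ×ˢ Sᶜ := Finset.mem_product.2 ⟨hp, hk⟩
    have := Finset.inf'_le (fun pk : Fin N × Fin N => dist (x pk.1 + τ • e) (x pk.2)) hmem
    change f τ ≤ dist (x p + τ • e) (x k) at this
    linarith
  obtain ⟨q, hq, hq1⟩ := Finset.exists_mem_eq_inf' hPK
    (fun pk : Fin N × Fin N => dist (x pk.1 + τ • e) (x pk.2))
  have hq1' : dist (x q.1 + τ • e) (x q.2) = 1 := by
    rw [← hq1]
    exact hτ
  have hv : ∀ p ∈ S, ∀ k ∈ Sᶜ, x p + τ • e ≠ x k := fun p hp k hk h => by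
    have := hge1 p hp k hk
    rw [h, dist_self] at this
    exact absurd this (by norm_num)
  -- compare with the docked slide
  have hle := surgery_cross_le_translate hx S (τ • e) hv
  have hsum : ∑ p ∈ S, ∑ k ∈ Sᶜ, lennardJones (dist (x p + τ • e) (x k)) ≤ -1 / 12 := by
    rw [← Finset.sum_product' (f := fun p k => lennardJones (dist (x p + τ • e) (x k))),
      ← Finset.add_sum_erase _ _ hq]
    have h0 : ∑ pk ∈ (S ×ˢ Sᶜ).erase q, lennardJones (dist (x pk.1 + τ • e) (x pk.2)) ≤ 0 :=
      Finset.sum_nonpos fun pk hpk => by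
        obtain ⟨hp, hk⟩ := Finset.mem_product.1 (Finset.mem_of_mem_erase hpk)
        exact lennardJones_nonpos (hge1 _ hp _ hk)
    have h1 : lennardJones (dist (x q.1 + τ • e) (x q.2)) = -1 / 12 := by
      rw [hq1', lennardJones_one]
    linarith
  exact hle.trans hsum

/-- **Registered sub-goal `stub_groupBinding` of line `Sketch` (cohesion side, toward `stub_noFoam`):
every non-empty proper group of particles of a Lennard-Jones ground state in `ℝᵈ` binds to its
complement by at least one bond, `∑_{p ∈ S} ∑_{k ∉ S} V_LJ ≤ -1/12`. [folklore] -/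
theorem stub_groupBinding :
    ∀ (d N : ℕ) (x : Fin N → EuclideanSpace ℝ (Fin d)), IsGroundState lennardJones x →
      ∀ S : Finset (Fin N), S.Nonempty → Sᶜ.Nonempty →
        ∑ p ∈ S, ∑ k ∈ Sᶜ, lennardJones (dist (x p) (x k)) ≤ -1 / 12 :=
  fun _ _ _ hx S hS hSc => surgery_cross_le_lennardJones_one hx S hS hSc

end Summit.AtomisticToContinuum.Crystallization.Theorems.LjLaminarWindowsSketch

end
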